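import Literature.AlgebraicGeometry.GroupSchemes.StrictBirationalGroupLaw
import Literature.NumberTheory.EllipticCurves.NeronModelAbelianScheme
import HarnessLib

/-!
# Associativity of a partial group law on a smooth separated `R`-scheme from its generic fibre
# (Edixhoven–Romagny Def. 3.4 (3) for laws obtained by extension from a `K`-group; BLR §5.1)

Topic `Literature/AlgebraicGeometry/GroupSchemes`, namespace `Literature.AlgebraicGeometry.GroupSchemes`.  THEOREMS ONLY.
Cell `hodgecm-mathlib`, road W (r₀), (W0) packaging leaf (A2) «`assoc`»: let `R` be a discrete valuation ring with
fraction field `K`, `𝒳 → Spec R` smooth and separated, `E` a `K`-group scheme with `𝒳_K ≅ E` (`e`), and `(dom, mul)`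
law data on `𝒳` (an `R`-morphism `mul : dom → 𝒳` on an open `dom ⊆ 𝒳 ×_R 𝒳`) whose generic fibre is the group law of
`E` (the clause of the (W0) statement).  THEN the associativity field of `BirationalGroupLaw` holds: on `T`-valued
points, `(ab)c = a(bc)` whenever the four products are defined.
PROOF. (1) UNIVERSAL EQUALITY over a FLAT `R`-scheme `W`: for `R`-morphisms `W → dom` computing `ab`, `bc`, `(ab)c`,
`a(bc)`, the two composites `W ⇉ 𝒳` agree — their generic fibres, composed with `e`, are the products `(a′b′)c′` and
`a′(b′c′)` in the GROUP `Hom_K(W_K, E)` (Mathlib `Hom.group`; the generic clause turns `mul` into `μ_E`), equal by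
`mul_assoc`; and `R`-morphisms from a flat source to a separated target with equal generic fibres are equal
(★ `map_genericFibre_injective`).  (2) The universal flat `W` is the open `V ⊆ 𝒳 ×_R 𝒳 ×_R 𝒳` where the four products
are defined (open in a smooth `R`-scheme); any `T`-point with the four witnesses factors through `V`.
HC_CM is proved only modulo the 7 printed citations until rung 0 closes; banked leaf, no floor change.

## References
* [EdixhovenRomagny2012] B. Edixhoven, M. Romagny, *Group schemes out of birational group laws, Néron models*
  (arXiv:1204.1799), Def. 3.4 (3), §6 (the law of a weak Néron model comes from the generic group).
* [BLRNeronModels1990] S. Bosch, W. Lütkebohmert, M. Raynaud, *Néron Models* (1990), §5.1 Def. 1, §4.3.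
-/

noncomputable section

set_option backward.isDefEq.respectTransparency false

universe u

namespace Literature.AlgebraicGeometry.GroupSchemes

open CategoryTheory Limits _root_.AlgebraicGeometry MonoidalCategory CartesianMonoidalCategory
open Literature.NumberTheory.EllipticCurves
open scoped MonObj CategoryTheory.Obj

variable (R : Type u) [CommRing R] [IsDomain R] [IsDiscreteValuationRing R]
  (K : Type u) [Field K] [Algebra R K] [IsFractionRing R K]
  (𝒳 : Over (Spec (.of R))) (E : Over (Spec (.of K))) [GrpObj E] (e : (genericFibre R K).obj 𝒳 ≅ E)
  (dom : (𝒳 ⊗ 𝒳).left.Opens) (mul : (dom : Scheme.{u}) ⟶ 𝒳.left) (hm : mul ≫ 𝒳.hom = dom.ι ≫ (𝒳 ⊗ 𝒳).hom)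
  (hgen : (genericFibre R K).map (Over.homMk mul hm : Over.mk (dom.ι ≫ (𝒳 ⊗ 𝒳).hom) ⟶ 𝒳) ≫ e.hom =
    (genericFibre R K).map (Over.homMk dom.ι rfl : Over.mk (dom.ι ≫ (𝒳 ⊗ 𝒳).hom) ⟶ 𝒳 ⊗ 𝒳) ≫
      Functor.OplaxMonoidal.δ (genericFibre R K) 𝒳 𝒳 ≫ (e.hom ⊗ₘ e.hom) ≫ μ[E])

/-! ## §1. The generic fibre of a product is the group product -/

include hgen in
omit [IsDomain R] [IsDiscreteValuationRing R] [IsFractionRing R K] in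
/-- **The generic clause in group form**: for an `R`-morphism `q : W → dom` with `q ≫ incl = (x, y)`, the generic fibre
of `q ≫ mul`, read in `E` through `e`, is the product `x′ · y′` of the generic fibres of `x` and `y` in the group
`Hom_K(W_K, E)`. [cite: EdixhovenRomagny2012, Def. 3.4] -/
theorem map_comp_mul_eq_mul {W : Over (Spec (.of R))}
    (q : W ⟶ Over.mk (dom.ι ≫ (𝒳 ⊗ 𝒳).hom)) (x y : W ⟶ 𝒳)
    (hq : q ≫ (Over.homMk dom.ι rfl : Over.mk (dom.ι ≫ (𝒳 ⊗ 𝒳).hom) ⟶ 𝒳 ⊗ 𝒳) = lift x y) :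
    (genericFibre R K).map (q ≫ Over.homMk mul hm) ≫ e.hom =
      ((genericFibre R K).map x ≫ e.hom) * ((genericFibre R K).map y ≫ e.hom) := by
  rw [Functor.map_comp, Category.assoc, hgen, ← Functor.map_comp_assoc, hq, Functor.OplaxMonoidal.lift_δ_assoc,
    lift_map_assoc, ← Hom.mul_def]

/-! ## §2. The universal equality over a flat base -/

include hgen in
omit [IsDomain R] [IsDiscreteValuationRing R] in
/-- **Associativity over a FLAT `R`-scheme** (the universal case): for `W → Spec R` flat and `R`-morphisms
`W → dom` computing `ab`, `bc`, `(ab)c` and `a(bc)`, the two triple products `W → 𝒳` coincide — their generic fibres are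
`(a′b′)c′ = a′(b′c′)` in the group `Hom_K(W_K, E)`, and `𝒳` is separated over `R` (★ `map_genericFibre_injective`).
[cite: EdixhovenRomagny2012, Def. 3.4 (3)] [cite: BLRNeronModels1990, §5.1 Def. 1] -/
theorem comp_mul_eq_comp_mul_of_flat [IsSeparated 𝒳.hom] {W : Over (Spec (.of R))} [Flat W.hom]
    (pa pb pc : W ⟶ 𝒳) (qab qbc qab_c qa_bc : W ⟶ Over.mk (dom.ι ≫ (𝒳 ⊗ 𝒳).hom))
    (hab : qab ≫ (Over.homMk dom.ι rfl : Over.mk (dom.ι ≫ (𝒳 ⊗ 𝒳).hom) ⟶ 𝒳 ⊗ 𝒳) = lift pa pb)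
    (hbc : qbc ≫ (Over.homMk dom.ι rfl : Over.mk (dom.ι ≫ (𝒳 ⊗ 𝒳).hom) ⟶ 𝒳 ⊗ 𝒳) = lift pb pc)
    (hab_c : qab_c ≫ (Over.homMk dom.ι rfl : Over.mk (dom.ι ≫ (𝒳 ⊗ 𝒳).hom) ⟶ 𝒳 ⊗ 𝒳) =
      lift (qab ≫ Over.homMk mul hm) pc)
    (ha_bc : qa_bc ≫ (Over.homMk dom.ι rfl : Over.mk (dom.ι ≫ (𝒳 ⊗ 𝒳).hom) ⟶ 𝒳 ⊗ 𝒳) =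
      lift pa (qbc ≫ Over.homMk mul hm)) :
    qab_c ≫ Over.homMk mul hm = qa_bc ≫ Over.homMk mul hm := by
  apply map_genericFibre_injective R K 𝒳 W
  change (genericFibre R K).map (qab_c ≫ Over.homMk mul hm) = (genericFibre R K).map (qa_bc ≫ Over.homMk mul hm)
  rw [← cancel_mono e.hom, map_comp_mul_eq_mul R K 𝒳 E e dom mul hm hgen qab_c _ _ hab_c,
    map_comp_mul_eq_mul R K 𝒳 E e dom mul hm hgen qa_bc _ _ ha_bc,
    map_comp_mul_eq_mul R K 𝒳 E e dom mul hm hgen qab _ _ hab,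
    map_comp_mul_eq_mul R K 𝒳 E e dom mul hm hgen qbc _ _ hbc, mul_assoc]

/-! ## §3. Plumbing: open sub-`S`-schemes -/

section OpenOver

variable {S : Scheme.{u}}

omit R K 𝒳 E e dom mul hm in
/-- A morphism into `X` whose image lies in the open `O ⊆ X` factors through the open sub-`S`-scheme `O`.
[folklore] -/
private theorem exists_lift_openOver {X T : Over S} (O : X.left.Opens) (g : T ⟶ X)
    (h : Set.range g.left.base ⊆ (O : Set X.left)) :
    ∃ t : T ⟶ Over.mk (O.ι ≫ X.hom), t ≫ Over.homMk O.ι rfl = g := by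
  have h' : Set.range g.left.base ⊆ Set.range O.ι.base := by rwa [Scheme.Opens.range_ι]
  refine ⟨Over.homMk (IsOpenImmersion.lift O.ι g.left h') ?_, ?_⟩
  · change IsOpenImmersion.lift O.ι g.left h' ≫ O.ι ≫ X.hom = T.hom
    rw [IsOpenImmersion.lift_fac_assoc, Over.w g]
  · ext : 1
    exact IsOpenImmersion.lift_fac _ _ _

omit R K 𝒳 E e dom mul hm in
/-- The inclusion of an open sub-`S`-scheme is a monomorphism of `S`-schemes. [folklore] -/
private theorem cancel_openOver {X T : Over S} (O : X.left.Opens) {x y : T ⟶ Over.mk (O.ι ≫ X.hom)}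
    (h : x ≫ Over.homMk O.ι rfl = y ≫ Over.homMk O.ι rfl) : x = y := by
  ext : 1
  rw [← cancel_mono O.ι]
  exact congrArg CommaMorphism.left h

omit R K 𝒳 E e dom mul hm in
/-- The image of `x ≫ (O ↪ X)` lies in `O`. [folklore] -/
private theorem range_comp_openOver_subset {X T : Over S} (O : X.left.Opens) (x : T ⟶ Over.mk (O.ι ≫ X.hom)) :
    Set.range (x ≫ Over.homMk O.ι rfl).left.base ⊆ (O : Set X.left) := by
  change Set.range (x.left ≫ O.ι).base ⊆ _
  rw [Scheme.Hom.comp_base, TopCat.coe_comp, Set.range_comp, ← Scheme.Opens.range_ι O]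
  exact Set.image_subset_range _ _

end OpenOver

/-! ## §4. The head: associativity on `T`-valued points -/

include hgen in
omit [IsDomain R] [IsDiscreteValuationRing R] in
/-- **Associativity of an extended group law on `T`-valued points** — the `assoc` field of ★ `BirationalGroupLaw` for
law data `(dom, mul)` on a smooth separated `R`-scheme `𝒳` whose generic fibre is the group law of `E`: whenever `ab`,
`bc`, `(ab)c`, `a(bc)` are computed by `T`-points `q₁ … q₄` of `dom`, `(ab)c = a(bc)`.  Proof: the `T`-point
`(a, b, c)` factors through the open `V ⊆ 𝒳 ×_R 𝒳 ×_R 𝒳` where the four products are defined, which is FLAT over `R`;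
there the two composites agree by `comp_mul_eq_comp_mul_of_flat`.
[cite: EdixhovenRomagny2012, Def. 3.4 (3)] [cite: BLRNeronModels1990, §5.1 Def. 1] -/
theorem LawData.assoc_of_genericFibre [Smooth 𝒳.hom] [IsSeparated 𝒳.hom]
    {T : Scheme.{u}} {a b c ab bc abc abc' : T ⟶ 𝒳.left} {q₁ q₂ q₃ q₄ : T ⟶ (dom : Scheme.{u})}
    (h₁ : LawData.Computes 𝒳 dom mul q₁ a b ab) (h₂ : LawData.Computes 𝒳 dom mul q₂ b c bc)
    (h₃ : LawData.Computes 𝒳 dom mul q₃ ab c abc) (h₄ : LawData.Computes 𝒳 dom mul q₄ a bc abc') :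
    abc = abc' := by
  obtain ⟨h₁a, h₁b, h₁m⟩ := h₁
  obtain ⟨h₂a, h₂b, h₂m⟩ := h₂
  obtain ⟨h₃a, h₃b, h₃m⟩ := h₃
  obtain ⟨h₄a, h₄b, h₄m⟩ := h₄
  -- `T` as an `R`-scheme through `a`; all the data are `R`-morphisms
  let TR : Over (Spec (.of R)) := Over.mk (a ≫ 𝒳.hom)
  have hq₁ : (q₁ ≫ dom.ι ≫ (𝒳 ⊗ 𝒳).hom) = a ≫ 𝒳.hom := by
    rw [← h₁a]; simp only [Category.assoc, Over.w (fst 𝒳 𝒳)]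
  have hb : b ≫ 𝒳.hom = a ≫ 𝒳.hom := by
    rw [← h₁b, ← h₁a]; simp only [Category.assoc, Over.w (snd 𝒳 𝒳), Over.w (fst 𝒳 𝒳)]
  have hq₂ : (q₂ ≫ dom.ι ≫ (𝒳 ⊗ 𝒳).hom) = a ≫ 𝒳.hom := by
    rw [← hb, ← h₂a]; simp only [Category.assoc, Over.w (fst 𝒳 𝒳)]
  have hc : c ≫ 𝒳.hom = a ≫ 𝒳.hom := by
    rw [← hb, ← h₂b, ← h₂a]; simp only [Category.assoc, Over.w (snd 𝒳 𝒳), Over.w (fst 𝒳 𝒳)]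
  have hab : ab ≫ 𝒳.hom = a ≫ 𝒳.hom := by rw [← h₁m, Category.assoc, hm, hq₁]
  have hq₃ : (q₃ ≫ dom.ι ≫ (𝒳 ⊗ 𝒳).hom) = a ≫ 𝒳.hom := by
    rw [← hab, ← h₃a]; simp only [Category.assoc, Over.w (fst 𝒳 𝒳)]
  have hq₄ : (q₄ ≫ dom.ι ≫ (𝒳 ⊗ 𝒳).hom) = a ≫ 𝒳.hom := by
    rw [← h₄a]; simp only [Category.assoc, Over.w (fst 𝒳 𝒳)]
  let aR : TR ⟶ 𝒳 := Over.homMk a rfl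
  let bR : TR ⟶ 𝒳 := Over.homMk b hb
  let cR : TR ⟶ 𝒳 := Over.homMk c hc
  let q₁R : TR ⟶ Over.mk (dom.ι ≫ (𝒳 ⊗ 𝒳).hom) := Over.homMk q₁ hq₁
  let q₂R : TR ⟶ Over.mk (dom.ι ≫ (𝒳 ⊗ 𝒳).hom) := Over.homMk q₂ hq₂
  let q₃R : TR ⟶ Over.mk (dom.ι ≫ (𝒳 ⊗ 𝒳).hom) := Over.homMk q₃ hq₃
  let q₄R : TR ⟶ Over.mk (dom.ι ≫ (𝒳 ⊗ 𝒳).hom) := Over.homMk q₄ hq₄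
  -- notation for the incl / mul of `dom` as `R`-morphisms
  let incl : Over.mk (dom.ι ≫ (𝒳 ⊗ 𝒳).hom) ⟶ 𝒳 ⊗ 𝒳 := Over.homMk dom.ι rfl
  let mulR : Over.mk (dom.ι ≫ (𝒳 ⊗ 𝒳).hom) ⟶ 𝒳 := Over.homMk mul hm
  have hq₁R : q₁R ≫ incl = lift aR bR := by
    ext <;> simp [q₁R, incl, aR, bR, ← h₁a, ← h₁b]
  have hq₂R : q₂R ≫ incl = lift bR cR := by
    ext <;> simp [q₂R, incl, bR, cR, ← h₂a, ← h₂b]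
  have hq₃R : q₃R ≫ incl = lift (q₁R ≫ mulR) cR := by
    ext <;> simp [q₃R, q₁R, incl, mulR, cR, h₁m, ← h₃a, ← h₃b]
  have hq₄R : q₄R ≫ incl = lift aR (q₂R ≫ mulR) := by
    ext <;> simp [q₄R, q₂R, incl, mulR, aR, h₂m, ← h₄a, ← h₄b]
  -- the universal scheme: `O₁ ⊆ (𝒳 ⊗ 𝒳) ⊗ 𝒳` where `ab` and `bc` are defined …
  let Y3 : Over (Spec (.of R)) := (𝒳 ⊗ 𝒳) ⊗ 𝒳
  let p12 : Y3 ⟶ 𝒳 ⊗ 𝒳 := fst _ _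
  let p23 : Y3 ⟶ 𝒳 ⊗ 𝒳 := lift (fst _ _ ≫ snd 𝒳 𝒳) (snd _ _)
  let O₁ : Y3.left.Opens := p12.left ⁻¹ᵁ dom ⊓ p23.left ⁻¹ᵁ dom
  let W₁ : Over (Spec (.of R)) := Over.mk (O₁.ι ≫ Y3.hom)
  let j₁ : W₁ ⟶ Y3 := Over.homMk O₁.ι rfl
  have hr12 : Set.range (j₁ ≫ p12).left.base ⊆ (dom : Set (𝒳 ⊗ 𝒳).left) := by
    rintro _ ⟨x, rfl⟩
    exact (x.2 : O₁.ι.base x ∈ O₁).1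
  have hr23 : Set.range (j₁ ≫ p23).left.base ⊆ (dom : Set (𝒳 ⊗ 𝒳).left) := by
    rintro _ ⟨x, rfl⟩
    exact (x.2 : O₁.ι.base x ∈ O₁).2
  obtain ⟨qab₁, hqab₁⟩ := exists_lift_openOver dom (j₁ ≫ p12) hr12
  obtain ⟨qbc₁, hqbc₁⟩ := exists_lift_openOver dom (j₁ ≫ p23) hr23
  -- … and `O ⊆ O₁` where moreover `(ab)c` and `a(bc)` are defined
  let r₃ : W₁ ⟶ 𝒳 ⊗ 𝒳 := lift (qab₁ ≫ mulR) (j₁ ≫ snd _ _)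
  let r₄ : W₁ ⟶ 𝒳 ⊗ 𝒳 := lift (j₁ ≫ fst _ _ ≫ fst 𝒳 𝒳) (qbc₁ ≫ mulR)
  let O : W₁.left.Opens := r₃.left ⁻¹ᵁ dom ⊓ r₄.left ⁻¹ᵁ dom
  let W : Over (Spec (.of R)) := Over.mk (O.ι ≫ W₁.hom)
  let j : W ⟶ W₁ := Over.homMk O.ι rfl
  have hr₃ : Set.range (j ≫ r₃).left.base ⊆ (dom : Set (𝒳 ⊗ 𝒳).left) := by
    rintro _ ⟨x, rfl⟩
    exact (x.2 : O.ι.base x ∈ O).1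
  have hr₄ : Set.range (j ≫ r₄).left.base ⊆ (dom : Set (𝒳 ⊗ 𝒳).left) := by
    rintro _ ⟨x, rfl⟩
    exact (x.2 : O.ι.base x ∈ O).2
  obtain ⟨qab_c, hqab_c⟩ := exists_lift_openOver dom (j ≫ r₃) hr₃
  obtain ⟨qa_bc, hqa_bc⟩ := exists_lift_openOver dom (j ≫ r₄) hr₄
  -- `W` is flat over `R` (an open of the smooth `(𝒳 ⊗ 𝒳) ⊗ 𝒳`)
  haveI : Flat (𝒳 ⊗ 𝒳).hom := inferInstanceAs (Flat (pullback.fst 𝒳.hom 𝒳.hom ≫ 𝒳.hom))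
  haveI : Flat Y3.hom := inferInstanceAs (Flat (pullback.fst (𝒳 ⊗ 𝒳).hom 𝒳.hom ≫ (𝒳 ⊗ 𝒳).hom))
  haveI : Flat W.hom := inferInstanceAs (Flat (O.ι ≫ O₁.ι ≫ Y3.hom))
  -- the universal equality on `W`
  have huniv := comp_mul_eq_comp_mul_of_flat R K 𝒳 E e dom mul hm hgen (W := W)
    (j ≫ j₁ ≫ fst _ _ ≫ fst 𝒳 𝒳) (j ≫ j₁ ≫ fst _ _ ≫ snd 𝒳 𝒳) (j ≫ j₁ ≫ snd _ _)
    (j ≫ qab₁) (j ≫ qbc₁) qab_c qa_bc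
    (by rw [Category.assoc, hqab₁]; ext <;> simp only [p12, Category.assoc, lift_fst, lift_snd])
    (by rw [Category.assoc, hqbc₁]; ext <;> simp only [p23, comp_lift, lift_fst, lift_snd])
    (by rw [hqab_c]; simp only [r₃, mulR, comp_lift, Category.assoc])
    (by rw [hqa_bc]; simp only [r₄, mulR, comp_lift, Category.assoc])
  -- the `T`-point `(a, b, c)` factors through `W₁` …
  let tR : TR ⟶ Y3 := lift (lift aR bR) cR
  have ht12 : tR ≫ p12 = q₁R ≫ incl := by rw [hq₁R]; simp only [tR, p12, lift_fst]
  have ht23 : tR ≫ p23 = q₂R ≫ incl := by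
    rw [hq₂R]; ext <;> simp only [tR, p23, comp_lift, lift_fst, lift_snd, lift_fst_assoc]
  have htO₁ : Set.range tR.left.base ⊆ (O₁ : Set Y3.left) := by
    rintro _ ⟨x, rfl⟩
    refine ⟨?_, ?_⟩
    · change (tR.left ≫ p12.left).base x ∈ (dom : Set (𝒳 ⊗ 𝒳).left)
      rw [← Over.comp_left, ht12]
      exact range_comp_openOver_subset dom q₁R ⟨x, rfl⟩
    · change (tR.left ≫ p23.left).base x ∈ (dom : Set (𝒳 ⊗ 𝒳).left)
      rw [← Over.comp_left, ht23]
      exact range_comp_openOver_subset dom q₂R ⟨x, rfl⟩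
  obtain ⟨t₁, ht₁⟩ := exists_lift_openOver O₁ tR htO₁
  have ht₁ab : t₁ ≫ qab₁ = q₁R :=
    cancel_openOver dom (by rw [Category.assoc, hqab₁, ← Category.assoc, ht₁, ht12])
  have ht₁bc : t₁ ≫ qbc₁ = q₂R :=
    cancel_openOver dom (by rw [Category.assoc, hqbc₁, ← Category.assoc, ht₁, ht23])
  -- … and through `W`
  have ht₃ : t₁ ≫ r₃ = q₃R ≫ incl := by
    rw [hq₃R]
    simp only [r₃, comp_lift]
    rw [← Category.assoc t₁ qab₁, ht₁ab, ← Category.assoc t₁ j₁, ht₁]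
    simp only [tR, lift_snd]
  have ht₄ : t₁ ≫ r₄ = q₄R ≫ incl := by
    rw [hq₄R]
    simp only [r₄, comp_lift]
    rw [← Category.assoc t₁ qbc₁, ht₁bc, ← Category.assoc t₁ j₁, ht₁]
    simp only [tR, lift_fst_assoc, lift_fst]
  have htO : Set.range t₁.left.base ⊆ (O : Set W₁.left) := by
    rintro _ ⟨x, rfl⟩
    refine ⟨?_, ?_⟩
    · change (t₁.left ≫ r₃.left).base x ∈ (dom : Set (𝒳 ⊗ 𝒳).left)
      rw [← Over.comp_left, ht₃]
      exact range_comp_openOver_subset dom q₃R ⟨x, rfl⟩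
    · change (t₁.left ≫ r₄.left).base x ∈ (dom : Set (𝒳 ⊗ 𝒳).left)
      rw [← Over.comp_left, ht₄]
      exact range_comp_openOver_subset dom q₄R ⟨x, rfl⟩
  obtain ⟨t, ht⟩ := exists_lift_openOver O t₁ htO
  have ht₃' : t ≫ qab_c = q₃R :=
    cancel_openOver dom (by rw [Category.assoc, hqab_c, ← Category.assoc, ht, ht₃])
  have ht₄' : t ≫ qa_bc = q₄R :=
    cancel_openOver dom (by rw [Category.assoc, hqa_bc, ← Category.assoc, ht, ht₄])
  -- conclude
  have key : q₃R ≫ mulR = q₄R ≫ mulR := by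
    rw [← ht₃', ← ht₄', Category.assoc, Category.assoc, huniv]
  have := congrArg CommaMorphism.left key
  simpa [q₃R, q₄R, mulR, h₃m, h₄m] using this

end Literature.AlgebraicGeometry.GroupSchemes

end
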